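import Summits.SmoothPoincare4.SmoothPoincare4.Theorems.ConvexBisectionAcyclicBisectionExistsHurwitzMoveClasses
import Summits.SmoothPoincare4.SmoothPoincare4.Theorems.ConvexBisectionAcyclicBisectionExistsPicardLefschetzChart
import HarnessLib

/-!
# N1-move, bridge (e×) `piece_e_cross`, tool 3: the shadow of a loop read through the RETURN MAP of
# the belt chart is the transvected shadow (wave 8, worker J4, brick of stub `stub_M2geo` = node N1 ▸
# contract `node_N1_move_of_pieces` ▸ `HD` = `piece_e_cross piece_d`, line `modp-braid-orbits`, crux
# `ConvexBisection.AcyclicBisectionExists`, item stmt-SmoothPoincare4-10508; registered sub-goal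
# `helper_shadow_twistReading`)

H4's two-sided belt chart (piece (d)) reads the page loops ABOVE the belt page angle in the chart
coordinates composed with a RETURN MAP `G : ℝ × ℝ → ℝ × ℝ` — any continuous lift of an annulus map
with `G = id` for `r ≤ −1/2` and `G (u, r) = (u + n₀, r)` for `r ≥ 1/2`, `n₀ = if s then 1 else −1`
— not N1a's exact shear `(u, r) ↦ (u ± β r, r)`.  This file proves the class-level statement the
bridge (e×) needs (H4's `(e)-NOTE`): if `K` is a loop of the page `page g c` presented in an N1a chart
`φ` (six clauses) with an N1a-presented twist `τ`, and `L` is a `G`-TWIST READING of `K`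
(`L θ = φ (G p)` whenever `K θ = φ p`, `p` in the strip; `L θ = K θ` off the open annulus), then

  **`shadow L = transvection (stdSymp ℤ g) (shadow a, s) (shadow K)`**      (`shadow_twistReading_eq_transvection`).

Proof: the straight-line homotopy of lifts `G_t = (1 − t) G + t · shear` (§2: each `G_t` is again a
lift of the same kind) gives a homotopy of loops `φ ∘ G_t ∘ φ⁻¹ ∪ id` from `L` to `τ ∘ K` (§3; its
continuity is read through the chart, §1 `continuousOn_read_chart`, by the relative openness of N1a
charts `chart_relOpen`, and pasted over the closed cover "inside the `3/4`-annulus" / "outside the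
`5/8`-annulus", `isOpen_preimage_annulus`); then `shadow_eq_of_family` and node N1a
(`shadow_pageDehnTwist_eq_transvection`, p157857).

Everything is proved; no definitions, no named facts, no `sorry`.  References: B. Farb, D. Margalit,
*A primer on mapping class groups* (2012), Prop. 6.3 [FarbMargalit2012]; A. Hatcher, *Algebraic
Topology* (2002), §1.3 [HatcherAT2002]. [folklore]
-/

noncomputable section

set_option linter.dupNamespace false

open scoped Manifold ContDiff Topology Real
open Set Function Filter

namespace Summit.SmoothPoincare4.SmoothPoincare4.Theorems.AcyclicBisectionExists.ModpBraidOrbits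

open Literature.GroupTheory.CombinatorialGroupTheory.SignedHurwitz
open Literature.Topology.FourManifolds Literature.Topology.FourManifolds.LefschetzBase

namespace CrossTwist

variable {g : ℕ} {c : ℂ} {φ : ℝ × ℝ → Base g}

/-! ## §1 Reading a periodic function through an annulus chart -/

/-- Near a point of a page, every point of the base with `‖x‖² < 4` on no page at all is irrelevant:
a neighbourhood of a page point consists of points with `‖x‖² < 4`. [folklore] -/
theorem eventually_normSq_cx_lt {q₀ : Base g} (hq₀ : q₀ ∈ page g c) :
    ∀ᶠ q in 𝓝 q₀, ‖cx q.1‖ ^ 2 < 4 := by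
  have hcont : Continuous fun q : Base g => ‖cx q.1‖ ^ 2 :=
    ((contDiff_cx.continuous.comp continuous_subtype_val).norm).pow 2
  exact hcont.continuousAt.eventually_lt continuousAt_const hq₀.1

/-- A map `1`-periodic in the first variable is `ℤ`-periodic in it (any target). [folklore] -/
theorem periodic_int {Z : Type*} {F : ℝ × ℝ → Z} (hF1 : ∀ u r, F (u + 1, r) = F (u, r)) (m : ℤ)
    (u r : ℝ) : F (u + m, r) = F (u, r) := by
  induction m using Int.induction_on generalizing u with
  | zero => simp
  | succ k ih =>
    have h := hF1 (u + k) r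
    rw [add_assoc] at h
    have h' := ih u
    push_cast at h' ⊢
    rw [h, h']
  | pred k ih =>
    have h := hF1 (u + (-(k : ℝ) - 1)) r
    rw [add_assoc, show -(k : ℝ) - 1 + 1 = -(k : ℝ) by ring] at h
    have h' := ih u
    push_cast at h' ⊢
    rw [← h, h']

/-- **Reading through the chart is continuous.**  Let `φ` be an N1a annulus chart of `page g c`
(continuous, `1`-periodic, page-valued, injective on `[0, 1) × (−1, 1)`), `γ : Y → Base g` continuous
with values in the page wherever `‖x‖² < 4`, `F : Y → ℝ × ℝ → Z` jointly continuous and `1`-periodic in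
the abscissa, and `P y` (`y ∈ S`) a preimage of `γ y` in the strip.  Then `y ↦ F y (P y)` is continuous
on `S`, whatever the choice of preimages. [folklore] -/
theorem continuousOn_read_chart {Y Z : Type*} [TopologicalSpace Y] [TopologicalSpace Z]
    (hc : ‖c‖ = 1) (hφc : Continuous φ) (hφ1 : ∀ u r, φ (u + 1, r) = φ (u, r))
    (hφp : ∀ p, φ p ∈ page g c) (hφi : InjOn φ (Ico (0 : ℝ) 1 ×ˢ Ioo (-1 : ℝ) 1))
    {γ : Y → Base g} (hγ : Continuous γ) (hγp : ∀ y, ‖cx (γ y).1‖ ^ 2 < 4 → γ y ∈ page g c)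
    {F : Y → ℝ × ℝ → Z} (hF : Continuous (uncurry F)) (hF1 : ∀ y u r, F y (u + 1, r) = F y (u, r))
    {S : Set Y} {P : Y → ℝ × ℝ} (hP : ∀ y ∈ S, (P y).2 ∈ Ioo (-1 : ℝ) 1)
    (hPγ : ∀ y ∈ S, φ (P y) = γ y) : ContinuousOn (fun y => F y (P y)) S := by
  have hFint : ∀ y (m : ℤ) (u r : ℝ), F y (u + m, r) = F y (u, r) := fun y m u r =>
    periodic_int (hF1 y) m u r
  intro y₀ hy₀
  rw [ContinuousWithinAt, tendsto_nhds]
  intro U hU hU0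
  -- joint continuity of `F` at `(y₀, P y₀)`
  have hFat : ContinuousAt (uncurry F) (y₀, P y₀) := hF.continuousAt
  have hpre : (uncurry F) ⁻¹' U ∈ 𝓝 (y₀, P y₀) := hFat.preimage_mem_nhds (hU.mem_nhds hU0)
  rw [nhds_prod_eq, mem_prod_iff] at hpre
  obtain ⟨V, hV, N, hN, hVN⟩ := hpre
  have hN' : N ∩ univ ×ˢ Ioo (-1 : ℝ) 1 ∈ 𝓝 (P y₀) :=
    inter_mem hN ((isOpen_univ.prod isOpen_Ioo).mem_nhds ⟨trivial, hP y₀ hy₀⟩)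
  obtain ⟨O, hO, hOsub⟩ := chart_relOpen hc hφc hφ1 hφp hφi (hP y₀ hy₀) hN'
  rw [hPγ y₀ hy₀] at hO
  have hflat : ∀ᶠ q in 𝓝 (γ y₀), ‖cx q.1‖ ^ 2 < 4 :=
    eventually_normSq_cx_lt ((hPγ y₀ hy₀) ▸ hφp (P y₀))
  have h1 : ∀ᶠ y in 𝓝 y₀, γ y ∈ O ∧ ‖cx (γ y).1‖ ^ 2 < 4 :=
    hγ.continuousAt.eventually (Filter.inter_mem hO hflat)
  filter_upwards [mem_nhdsWithin_of_mem_nhds h1, mem_nhdsWithin_of_mem_nhds hV,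
    self_mem_nhdsWithin] with y hy hyV hyS
  obtain ⟨p, ⟨hpN, -, hp2⟩, hpy⟩ := hOsub (γ y) hy.1 (hγp y hy.2)
  show F y (P y) ∈ U
  obtain ⟨h2, m, hm⟩ := chart_eq_iff hφ1 hφi hp2 (hP y hyS) (hpy.trans (hPγ y hyS).symm)
  have e : P y = (p.1 + m, p.2) := by rw [← hm, h2]
  rw [e, hFint]
  exact hVN (mk_mem_prod hyV hpN)

/-- A sub-chart of smaller width `λ ∈ (0, 1]` is again injective on `[0, 1) × (−1, 1)`. [folklore] -/
theorem injOn_scaled (hφi : InjOn φ (Ico (0 : ℝ) 1 ×ˢ Ioo (-1 : ℝ) 1)) {lam : ℝ} (h0 : 0 < lam)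
    (h1 : lam ≤ 1) : InjOn (fun q : ℝ × ℝ => φ (q.1, lam * q.2)) (Ico (0 : ℝ) 1 ×ˢ Ioo (-1 : ℝ) 1) := by
  rintro ⟨u, r⟩ ⟨hu, hr⟩ ⟨u', r'⟩ ⟨hu', hr'⟩ h
  have hm : ∀ x ∈ Ioo (-1 : ℝ) 1, lam * x ∈ Ioo (-1 : ℝ) 1 := fun x hx =>
    ⟨by nlinarith [hx.1, hx.2], by nlinarith [hx.1, hx.2]⟩
  have e := hφi (⟨hu, hm r hr⟩ : (u, lam * r) ∈ Ico (0 : ℝ) 1 ×ˢ Ioo (-1 : ℝ) 1)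
    (⟨hu', hm r' hr'⟩ : (u', lam * r') ∈ Ico (0 : ℝ) 1 ×ˢ Ioo (-1 : ℝ) 1) h
  simp only [Prod.mk.injEq] at e
  exact Prod.ext e.1 (mul_left_cancel₀ h0.ne' e.2)

/-! ## §2 The straight-line homotopy of lifts -/

/-- **The lifts between the return map and the shear**: for a lift `G` (equivariant, the identity
below `r = −1/2`, the translation by `n₀` above `r = 1/2`, strip-preserving) and a profile `β` (`0`
below `−1/2`, `1` above `1/2`), every `G_t = (1 − t) G + t · ((u, r) ↦ (u + n₀ β r, r))`, `t ∈ [0, 1]`,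
is a lift of the same kind. [folklore] -/
theorem lift_homotopy_clauses {G : ℝ × ℝ → ℝ × ℝ} {n₀ : ℝ} {β : ℝ → ℝ}
    (hG1 : ∀ u r, G (u + 1, r) = G (u, r) + (1, 0))
    (hGlo : ∀ u r, r ≤ -(1 / 2 : ℝ) → G (u, r) = (u, r))
    (hGhi : ∀ u r, (1 / 2 : ℝ) ≤ r → G (u, r) = (u + n₀, r))
    (hGstrip : ∀ u r, r ∈ Ioo (-1 : ℝ) 1 → (G (u, r)).2 ∈ Ioo (-1 : ℝ) 1)
    (hβ0 : ∀ r ≤ -(1 / 2 : ℝ), β r = 0) (hβ1 : ∀ r ≥ (1 / 2 : ℝ), β r = 1) (t : ℝ) :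
    let Gt : ℝ × ℝ → ℝ × ℝ := fun p =>
      ((1 - t) * (G p).1 + t * (p.1 + n₀ * β p.2), (1 - t) * (G p).2 + t * p.2)
    (∀ u r, Gt (u + 1, r) = Gt (u, r) + (1, 0)) ∧
    (∀ u r, r ≤ -(1 / 2 : ℝ) → Gt (u, r) = (u, r)) ∧
    (∀ u r, (1 / 2 : ℝ) ≤ r → Gt (u, r) = (u + n₀, r)) ∧
    (t ∈ Icc (0 : ℝ) 1 → ∀ u r, r ∈ Ioo (-1 : ℝ) 1 → (Gt (u, r)).2 ∈ Ioo (-1 : ℝ) 1) := by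
  intro Gt
  refine ⟨fun u r => ?_, fun u r hr => ?_, fun u r hr => ?_, fun ht u r hr => ?_⟩
  · show ((1 - t) * (G (u + 1, r)).1 + t * (u + 1 + n₀ * β r), (1 - t) * (G (u + 1, r)).2 + t * r) =
      ((1 - t) * (G (u, r)).1 + t * (u + n₀ * β r), (1 - t) * (G (u, r)).2 + t * r) + (1, 0)
    rw [hG1, Prod.fst_add, Prod.snd_add]
    refine Prod.ext ?_ ?_
    · simp; ring
    · simp
  · show ((1 - t) * (G (u, r)).1 + t * (u + n₀ * β r), (1 - t) * (G (u, r)).2 + t * r) = (u, r)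
    rw [hGlo u r hr, hβ0 r hr]
    refine Prod.ext ?_ ?_ <;> simp <;> ring
  · show ((1 - t) * (G (u, r)).1 + t * (u + n₀ * β r), (1 - t) * (G (u, r)).2 + t * r) = (u + n₀, r)
    rw [hGhi u r hr, hβ1 r hr]
    refine Prod.ext ?_ ?_ <;> simp <;> ring
  · show (1 - t) * (G (u, r)).2 + t * r ∈ Ioo (-1 : ℝ) 1
    have h := hGstrip u r hr
    rcases le_or_gt t (1 / 2) with ht' | ht'
    · have h1 : 0 < (1 - t) * ((G (u, r)).2 + 1) := mul_pos (by linarith) (by linarith [h.1])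
      have h2 : 0 ≤ t * (r + 1) := mul_nonneg ht.1 (by linarith [hr.1])
      have h3 : 0 < (1 - t) * (1 - (G (u, r)).2) := mul_pos (by linarith) (by linarith [h.2])
      have h4 : 0 ≤ t * (1 - r) := mul_nonneg ht.1 (by linarith [hr.2])
      constructor <;> nlinarith [h1, h2, h3, h4]
    · have h1 : 0 ≤ (1 - t) * ((G (u, r)).2 + 1) := mul_nonneg (by linarith [ht.2]) (by linarith [h.1])
      have h2 : 0 < t * (r + 1) := mul_pos (by linarith) (by linarith [hr.1])
      have h3 : 0 ≤ (1 - t) * (1 - (G (u, r)).2) := mul_nonneg (by linarith [ht.2]) (by linarith [h.2])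
      have h4 : 0 < t * (1 - r) := mul_pos (by linarith) (by linarith [hr.2])
      constructor <;> nlinarith [h1, h2, h3, h4]

/-! ## §3 The shadow of a twist reading -/

/-- **The shadow of a `G`-twist reading of a page loop is the transvected shadow.**  Data: an N1a chart
`φ` of `page g c` around the page curve `a` with an N1a-presented twist `τ` (the hypotheses of node N1a
`shadow_pageDehnTwist_eq_transvection` verbatim), a continuous lift `G` of an annulus map (equivariant,
the identity for `r ≤ −1/2`, the translation by `n₀ = if s then 1 else −1` for `r ≥ 1/2`,
strip-preserving), a loop `K` of the page and a continuous loop `L` which is a `G`-TWIST READING of `K`: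
`L θ = φ (G p)` whenever `K θ = φ p` with `p` in the strip, and `L θ = K θ` off the open annulus.  Then
`shadow L = transvection (stdSymp ℤ g) (shadow a, s) (shadow K)` — `L` is homotopic to `τ ∘ K` by the
straight-line homotopy of lifts. [cite: FarbMargalit2012, Prop. 6.3] -/
theorem shadow_twistReading_eq_transvection (hc : ‖c‖ = 1) (τ : Base g → Base g) (hτ : Continuous τ)
    {a : Metric.sphere (0 : EuclideanSpace ℝ (Fin 2)) 1 → Base g} (ha : Continuous a) (s : Bool)
    (φ : ℝ × ℝ → Base g) (β : ℝ → ℝ)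
    (hφs : ContMDiff 𝓘(ℝ, ℝ × ℝ) (𝓡∂ 4) ∞ φ) (hφ1 : ∀ u r, φ (u + 1, r) = φ (u, r))
    (hφa : ∀ u, φ (u, 0) = a (circlePt u)) (hφp : ∀ p, φ p ∈ page g c)
    (hφi : InjOn φ (Ico (0 : ℝ) 1 ×ˢ Ioo (-1 : ℝ) 1))
    (hφo : ∀ u r, r ∈ Ioo (-1 : ℝ) 1 →
      0 < inner ℝ (deriv (fun r' => (φ (u, r')).1) r) (cplxJ (deriv (fun u' => (φ (u', r)).1) u)))
    (hβs : ContDiff ℝ ∞ β) (hβ0 : ∀ r ≤ -(1 / 2 : ℝ), β r = 0) (hβ1 : ∀ r ≥ (1 / 2 : ℝ), β r = 1)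
    (hτon : ∀ u r, r ∈ Ioo (-1 : ℝ) 1 → τ (φ (u, r)) = φ (u + (if s then β r else -β r), r))
    (hτoff : ∀ p ∈ page g c, p ∉ φ '' (univ ×ˢ Ioo (-1 : ℝ) 1) → τ p = p)
    (G : ℝ × ℝ → ℝ × ℝ) (hGc : Continuous G) (hG1 : ∀ u r, G (u + 1, r) = G (u, r) + (1, 0))
    (hGlo : ∀ u r, r ≤ -(1 / 2 : ℝ) → G (u, r) = (u, r))
    (hGhi : ∀ u r, (1 / 2 : ℝ) ≤ r → G (u, r) = (u + (if s then 1 else -1), r))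
    (hGstrip : ∀ u r, r ∈ Ioo (-1 : ℝ) 1 → (G (u, r)).2 ∈ Ioo (-1 : ℝ) 1)
    {K L : Metric.sphere (0 : EuclideanSpace ℝ (Fin 2)) 1 → Base g} (hK : Continuous K)
    (hKc : ∀ θ, K θ ∈ page g c) (hL : Continuous L)
    (hLon : ∀ θ (p : ℝ × ℝ), p.2 ∈ Ioo (-1 : ℝ) 1 → K θ = φ p → L θ = φ (G p))
    (hLoff : ∀ θ, K θ ∉ φ '' (univ ×ˢ Ioo (-1 : ℝ) 1) → L θ = K θ) :
    shadow g L hL = transvection (stdSymp ℤ g) (shadow g a ha, s) (shadow g K hK) := by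
  classical
  have hφc : Continuous φ := hφs.continuous
  set n₀ : ℝ := if s then 1 else -1 with hn₀
  -- the lifts `G_t`
  set Gt : ℝ → ℝ × ℝ → ℝ × ℝ := fun t p =>
    ((1 - t) * (G p).1 + t * (p.1 + n₀ * β p.2), (1 - t) * (G p).2 + t * p.2) with hGt
  have hGtc : Continuous (uncurry Gt) := by
    have hG' : Continuous fun q : ℝ × (ℝ × ℝ) => G q.2 := hGc.comp continuous_snd
    have hβ' : Continuous fun q : ℝ × (ℝ × ℝ) => β q.2.2 :=
      hβs.continuous.comp (continuous_snd.comp continuous_snd)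
    refine Continuous.prodMk ?_ ?_
    · exact ((continuous_const.sub continuous_fst).mul (continuous_fst.comp hG')).add
        (continuous_fst.mul ((continuous_fst.comp continuous_snd).add (continuous_const.mul hβ')))
    · exact ((continuous_const.sub continuous_fst).mul (continuous_snd.comp hG')).add
        (continuous_fst.mul (continuous_snd.comp continuous_snd))
  have hGt1 : ∀ t u r, Gt t (u + 1, r) = Gt t (u, r) + (1, 0) := fun t =>
    (lift_homotopy_clauses hG1 hGlo hGhi hGstrip hβ0 hβ1 t).1
  have hGtlo : ∀ t u r, r ≤ -(1 / 2 : ℝ) → Gt t (u, r) = (u, r) := fun t =>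
    (lift_homotopy_clauses hG1 hGlo hGhi hGstrip hβ0 hβ1 t).2.1
  have hGthi : ∀ t u r, (1 / 2 : ℝ) ≤ r → Gt t (u, r) = (u + n₀, r) := fun t =>
    (lift_homotopy_clauses hG1 hGlo hGhi hGstrip hβ0 hβ1 t).2.2.1
  have hGt0 : ∀ p, Gt 0 p = G p := fun p => by
    simp only [hGt]; refine Prod.ext ?_ ?_ <;> simp
  have hGtone : ∀ p : ℝ × ℝ, Gt 1 p = (p.1 + n₀ * β p.2, p.2) := fun p => by
    simp only [hGt]; refine Prod.ext ?_ ?_ <;> simp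
  -- `φ ∘ G_t` is `1`-periodic; off the half annulus it is `φ`
  have hφGt1 : ∀ t u r, φ (Gt t (u + 1, r)) = φ (Gt t (u, r)) := fun t u r => by
    rw [hGt1, show Gt t (u, r) + (1, 0) = ((Gt t (u, r)).1 + 1, (Gt t (u, r)).2) from
      Prod.ext rfl (add_zero _), hφ1]
  have hφGt_big : ∀ t u r, r ≤ -(1 / 2 : ℝ) ∨ (1 / 2 : ℝ) ≤ r → φ (Gt t (u, r)) = φ (u, r) := by
    rintro t u r (hr | hr)
    · rw [hGtlo t u r hr]
    · rw [hGthi t u r hr]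
      rcases Bool.eq_false_or_eq_true s with hs | hs
      · rw [show n₀ = 1 by simp [hn₀, hs], show u + (1 : ℝ) = u + ((1 : ℤ) : ℝ) by push_cast; ring,
          chart_periodic_int hφ1]
      · rw [show n₀ = -1 by simp [hn₀, hs], show u + (-1 : ℝ) = u + ((-1 : ℤ) : ℝ) by push_cast; ring,
          chart_periodic_int hφ1]
  -- preimages
  set P : Metric.sphere (0 : EuclideanSpace ℝ (Fin 2)) 1 → ℝ × ℝ := fun θ =>
    if h : ∃ p : ℝ × ℝ, p.2 ∈ Ioo (-1 : ℝ) 1 ∧ φ p = K θ then h.choose else (0, 0) with hP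
  have hPspec : ∀ θ, (∃ p : ℝ × ℝ, p.2 ∈ Ioo (-1 : ℝ) 1 ∧ φ p = K θ) →
      (P θ).2 ∈ Ioo (-1 : ℝ) 1 ∧ φ (P θ) = K θ := fun θ h => by
    simp only [hP, dif_pos h]; exact h.choose_spec
  have hin_iff : ∀ θ, K θ ∈ φ '' (univ ×ˢ Ioo (-1 : ℝ) 1) ↔
      ∃ p : ℝ × ℝ, p.2 ∈ Ioo (-1 : ℝ) 1 ∧ φ p = K θ := fun θ =>
    ⟨fun ⟨p, ⟨_, hp⟩, hpK⟩ => ⟨p, hp, hpK⟩, fun ⟨p, hp, hpK⟩ => ⟨p, ⟨trivial, hp⟩, hpK⟩⟩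
  -- the homotopy
  set H : ℝ → Metric.sphere (0 : EuclideanSpace ℝ (Fin 2)) 1 → Base g := fun t θ =>
    if ∃ p : ℝ × ℝ, p.2 ∈ Ioo (-1 : ℝ) 1 ∧ φ p = K θ then φ (Gt t (P θ)) else K θ with hH
  have hH0 : ∀ θ, H 0 θ = L θ := fun θ => by
    by_cases h : ∃ p : ℝ × ℝ, p.2 ∈ Ioo (-1 : ℝ) 1 ∧ φ p = K θ
    · simp only [hH, if_pos h, hGt0]
      exact (hLon θ (P θ) (hPspec θ h).1 (hPspec θ h).2.symm).symm
    · simp only [hH, if_neg h]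
      exact (hLoff θ ((hin_iff θ).not.2 h)).symm
  have hH1 : ∀ θ, H 1 θ = (τ ∘ K) θ := fun θ => by
    by_cases h : ∃ p : ℝ × ℝ, p.2 ∈ Ioo (-1 : ℝ) 1 ∧ φ p = K θ
    · simp only [hH, if_pos h, hGtone, comp_apply]
      rw [← (hPspec θ h).2, show P θ = ((P θ).1, (P θ).2) from rfl, hτon _ _ (hPspec θ h).1]
      congr 2
      cases s <;> simp [hn₀]
    · simp only [hH, if_neg h, comp_apply]
      exact (hτoff _ (hKc θ) ((hin_iff θ).not.2 h)).symm
  -- continuity: the closed cover of the circle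
  set C₁ : Set (Metric.sphere (0 : EuclideanSpace ℝ (Fin 2)) 1) :=
    K ⁻¹' (φ '' (Icc (0 : ℝ) 1 ×ˢ Icc (-(3 / 4) : ℝ) (3 / 4))) with hC₁
  set C₂ : Set (Metric.sphere (0 : EuclideanSpace ℝ (Fin 2)) 1) :=
    (K ⁻¹' ((fun q : ℝ × ℝ => φ (q.1, 5 / 8 * q.2)) '' (univ ×ˢ Ioo (-1 : ℝ) 1)))ᶜ with hC₂
  have hC₁c : IsClosed C₁ :=
    (((isCompact_Icc.prod isCompact_Icc).image hφc).isClosed).preimage hK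
  have hC₂c : IsClosed C₂ := by
    rw [hC₂, isClosed_compl_iff]
    exact isOpen_preimage_annulus hc (φ := fun q : ℝ × ℝ => φ (q.1, 5 / 8 * q.2))
      (hφc.comp (continuous_fst.prodMk (continuous_const.mul continuous_snd)))
      (fun u r => hφ1 u _) (fun q => hφp _) (injOn_scaled hφi (by norm_num) (by norm_num)) hK hKc
  have hcover : C₁ ∪ C₂ = univ := by
    refine eq_univ_of_forall fun θ => ?_
    by_cases h : ∃ p : ℝ × ℝ, p.2 ∈ Ioo (-1 : ℝ) 1 ∧ φ p = K θ
    · obtain ⟨p, hp, hpK⟩ := h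
      by_cases hr : |p.2| ≤ 3 / 4
      · left
        refine ⟨(Int.fract p.1, p.2), ⟨⟨Int.fract_nonneg _, (Int.fract_lt_one _).le⟩, abs_le.1 hr⟩, ?_⟩
        rw [chart_fract hφ1, hpK]
      · right
        rintro ⟨q, ⟨-, hq⟩, hqK⟩
        have hq' : (5 / 8 * q.2) ∈ Ioo (-1 : ℝ) 1 := ⟨by nlinarith [hq.1], by nlinarith [hq.2]⟩
        obtain ⟨h2, -, -⟩ := chart_eq_iff hφ1 hφi (p := (q.1, 5 / 8 * q.2)) (p' := p) hq' hp
          (hqK.trans hpK.symm)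
        simp only at h2
        have : |p.2| < 3 / 4 := by
          rw [← h2, abs_lt]; constructor <;> nlinarith [hq.1, hq.2]
        exact hr this.le
    · right
      rintro ⟨q, ⟨-, hq⟩, hqK⟩
      exact h ⟨(q.1, 5 / 8 * q.2), ⟨by nlinarith [hq.1], by nlinarith [hq.2]⟩, hqK⟩
  -- on `C₁`: read through the chart
  have hcont₁ : ContinuousOn (uncurry H) (univ ×ˢ C₁) := by
    have hin : ∀ θ ∈ C₁, ∃ p : ℝ × ℝ, p.2 ∈ Ioo (-1 : ℝ) 1 ∧ φ p = K θ := by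
      rintro θ ⟨p, ⟨-, hp⟩, hpK⟩
      exact ⟨p, ⟨by linarith [hp.1], by linarith [hp.2]⟩, hpK⟩
    have heq : ∀ q ∈ univ ×ˢ C₁, uncurry H q =
        (fun q : ℝ × Metric.sphere (0 : EuclideanSpace ℝ (Fin 2)) 1 => φ (Gt q.1 (P q.2))) q := by
      rintro ⟨t, θ⟩ ⟨-, hθ⟩
      simp only [uncurry, hH, if_pos (hin θ hθ)]
    refine ContinuousOn.congr ?_ heq
    refine continuousOn_read_chart (Y := ℝ × Metric.sphere (0 : EuclideanSpace ℝ (Fin 2)) 1)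
      hc hφc hφ1 hφp hφi (γ := fun q => K q.2) (hK.comp continuous_snd) (fun q _ => hKc q.2)
      (F := fun q p => φ (Gt q.1 p)) ?_ (fun q u r => hφGt1 q.1 u r)
      (P := fun q => P q.2) (fun q hq => (hPspec q.2 (hin q.2 hq.2)).1)
      (fun q hq => (hPspec q.2 (hin q.2 hq.2)).2)
    exact hφc.comp (hGtc.comp (continuous_fst.fst.prodMk continuous_snd))
  -- on `C₂`: the homotopy is constant
  have hcont₂ : ContinuousOn (uncurry H) (univ ×ˢ C₂) := by
    have heq : ∀ q ∈ univ ×ˢ C₂, uncurry H q =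
        (fun q : ℝ × Metric.sphere (0 : EuclideanSpace ℝ (Fin 2)) 1 => K q.2) q := by
      rintro ⟨t, θ⟩ ⟨-, hθ⟩
      simp only [uncurry]
      by_cases h : ∃ p : ℝ × ℝ, p.2 ∈ Ioo (-1 : ℝ) 1 ∧ φ p = K θ
      · simp only [hH, if_pos h]
        obtain ⟨hP2, hPK⟩ := hPspec θ h
        have hbig : (P θ).2 ≤ -(1 / 2 : ℝ) ∨ (1 / 2 : ℝ) ≤ (P θ).2 := by
          by_contra hcon
          push Not at hcon
          apply hθ
          refine ⟨((P θ).1, 8 / 5 * (P θ).2), ⟨trivial, ⟨by linarith [hcon.1], by linarith [hcon.2]⟩⟩, ?_⟩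
          show φ ((P θ).1, 5 / 8 * (8 / 5 * (P θ).2)) = K θ
          rw [show 5 / 8 * (8 / 5 * (P θ).2) = (P θ).2 by ring]
          exact hPK
        rw [show P θ = ((P θ).1, (P θ).2) from rfl, hφGt_big t _ _ hbig]
        exact hPK
      · simp only [hH, if_neg h]
    exact ContinuousOn.congr (hK.comp_continuousOn continuousOn_snd) heq
  have hHc : ContinuousOn (uncurry H) (Icc (0 : ℝ) 1 ×ˢ univ) := by
    have h := hcont₁.union_of_isClosed hcont₂ (isClosed_univ.prod hC₁c) (isClosed_univ.prod hC₂c)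
    rw [← prod_union, hcover] at h
    exact h.mono (prod_mono (subset_univ _) subset_rfl)
  -- conclude by homotopy invariance and node N1a
  rw [shadow_eq_of_family H hHc hL (hτ.comp hK) hH0 hH1]
  exact shadow_pageDehnTwist_eq_transvection g hc τ hτ ha s φ β hφs hφ1 hφa hφp hφi hφo hβs hβ0
    hβ1 hτon hτoff hK hKc

end CrossTwist

open CrossTwist

/-! ## The registered form -/

/-- **Sub-goal `helper_shadow_twistReading`** (J4, bridge (e×) of the N1 contract, tool 3, fully
qualified): the shadow of a `G`-twist reading of a page loop through the return map `G` of H4's belt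
chart is the transvected shadow — see `shadow_twistReading_eq_transvection`.
[cite: FarbMargalit2012, Prop. 6.3] -/
theorem helper_shadow_twistReading : ∀ (g : ℕ) (c : ℂ) (τ : Literature.Topology.FourManifolds.LefschetzBase.Base g → Literature.Topology.FourManifolds.LefschetzBase.Base g) (hτ : Continuous τ) (a : Metric.sphere (0 : EuclideanSpace ℝ (Fin 2)) 1 → Literature.Topology.FourManifolds.LefschetzBase.Base g) (ha : Continuous a) (s : Bool) (φ : ℝ × ℝ → Literature.Topology.FourManifolds.LefschetzBase.Base g) (β : ℝ → ℝ) (G : ℝ × ℝ → ℝ × ℝ) (K L : Metric.sphere (0 : EuclideanSpace ℝ (Fin 2)) 1 → Literature.Topology.FourManifolds.LefschetzBase.Base g) (hK : Continuous K) (hL : Continuous L), ‖c‖ = 1 → ContMDiff 𝓘(ℝ, ℝ × ℝ) (𝓡∂ 4) ∞ φ → (∀ u r, φ (u + 1, r) = φ (u, r)) → (∀ u, φ (u, 0) = a (Literature.Topology.FourManifolds.circlePt u)) → (∀ p, φ p ∈ Literature.Topology.FourManifolds.LefschetzBase.page g c) → Set.InjOn φ (Set.Ico (0 : ℝ) 1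 ×ˢ Set.Ioo (-1 : ℝ) 1) → (∀ u r, r ∈ Set.Ioo (-1 : ℝ) 1 → 0 < inner ℝ (deriv (fun r' => (φ (u, r')).1) r) (Literature.Topology.FourManifolds.LefschetzBase.cplxJ (deriv (fun u' => (φ (u', r)).1) u))) → ContDiff ℝ ∞ β → (∀ r ≤ -(1 / 2 : ℝ), β r = 0) → (∀ r ≥ (1 / 2 : ℝ), β r = 1) → (∀ u r, r ∈ Set.Ioo (-1 : ℝ) 1 → τ (φ (u, r)) = φ (u + (if s then β r else -β r), r)) → (∀ p ∈ Literature.Topology.FourManifolds.LefschetzBase.page g c, p ∉ φ '' (Set.univ ×ˢ Set.Ioo (-1 : ℝ) 1) → τ p = p) → Continuous G → (∀ u r, G (u + 1, r) = G (u, r) + (1, 0)) → (∀ u r, r ≤ -(1 / 2 : ℝ) → G (u, r) = (u, r)) → (∀ u r, (1 / 2 : ℝ) ≤ r → G (u, r) = (u + (if s then 1 else -1), r)) → (∀ u r, r ∈ Set.Ioo (-1 : ℝ) 1 → (G (u, r)).2 ∈ Set.Ioo (-1 : ℝ) 1) → (∀ θ, K θ ∈ Literature.Topology.FourManifolds.LefschetzBase.page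 g c) → (∀ θ (p : ℝ × ℝ), p.2 ∈ Set.Ioo (-1 : ℝ) 1 → K θ = φ p → L θ = φ (G p)) → (∀ θ, K θ ∉ φ '' (Set.univ ×ˢ Set.Ioo (-1 : ℝ) 1) → L θ = K θ) → Literature.Topology.FourManifolds.LefschetzBase.shadow g L hL = Literature.GroupTheory.CombinatorialGroupTheory.SignedHurwitz.transvection (Literature.GroupTheory.CombinatorialGroupTheory.SignedHurwitz.stdSymp ℤ g) (Literature.Topology.FourManifolds.LefschetzBase.shadow g a ha, s) (Literature.Topology.FourManifolds.LefschetzBase.shadow g K hK) :=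
  fun _ _ τ hτ _ ha s φ β G _ _ hK hL hc hφs hφ1 hφa hφp hφi hφo hβs hβ0 hβ1 hτon hτoff hGc hG1 hGlo
      hGhi hGstrip hKc hLon hLoff =>
    shadow_twistReading_eq_transvection hc τ hτ ha s φ β hφs hφ1 hφa hφp hφi hφo hβs hβ0 hβ1 hτon
      hτoff G hGc hG1 hGlo hGhi hGstrip hK hKc hL hLon hLoff

end Summit.SmoothPoincare4.SmoothPoincare4.Theorems.AcyclicBisectionExists.ModpBraidOrbits

end
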